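import Literature.AnabelianGeometry.EtaleTheta.Discharge.Sec3Thm37OfInputsCoset
import Literature.AnabelianGeometry.EtaleTheta.Discharge.Sec3Thm37UnitsWeak
import Literature.AnabelianGeometry.EtaleTheta.Discharge.Sec3Prop34CnstOfRlfRWeak
import Literature.AnabelianGeometry.EtaleTheta.Discharge.Sec3ConstantLineOfRlfWeak
import HarnessLib

/-!
# [EtTh] Theorem 3.7 (i)–(iv) — END KNIT at the three CONSTRUCTED Def. 3.6 (i) data over the WEAK vocabulary
# (`ofRlfZWeak` / `ofRlfQWeak` / `ofRlfRWeak`), residual binders literal (proof-only)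

S. Mochizuki, *The étale theta function and its Frobenioid-theoretic manifestations*, Publ. RIMS **45**
(2009) [EtTh], Thm. 3.7 (i)–(iv), PDF pp. 79–80 (printed pp. 305–306), proof p. 306 ll. 1–17
[cite: MochizukiEtTh2009, Thm 3.7 p.79]; [FrdI] Thm. 5.2 (ii)/(iii), Def. 4.5 [MochizukiFrdI2008].

WEAK-VOCABULARY TWIN of abc-iut-w5-d164's END KNIT files `Discharge/Sec3Thm37OfInputs.lean` (§§2–4),
`Sec3Thm37OfInputsCnst.lean` (§2) and `Sec3Thm37OfInputsCoset.lean` (node **EtTh:Thm3.7**, abc-iut-L2-lead gen 3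
R129).  Their vocabulary-generic closers `thm37_of_inputs` / `thm37_of_inputs_of_cnst` (any
`T : RealifiedDivisorMonoids V`, any monoid type) are consumed BY NAME; what changes is the DATUM: the strong
constructors `ofRlfZ` / `ofRlfQ` / `ofRlfR` take the printed Prop. 3.4 (i) at EVERY `Y`, which is VACUOUS at the
tempered coverings `Ÿ`, `Z_∞` with infinitely many special-fibre components (cell finding F-L2d2-1, kernel witness
`PerfFactorialProductCounterexample.not_isPerfFactorial_multiplicative_pi_nat`); abc-iut-L6-t12's weak constructors
`ofRlfZWeak` / `ofRlfQWeak` / `ofRlfRWeak` take `hpf : ∀ Y, IsPerfFactorialCof (Φ₀ Y)` (abc-iut-L2-t3's repaired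
reading, satisfiable there — `RealifiedDivisorMonoidsOfRlfWeakPiNat.lean`).  The `Prop34Cnst` inputs come from the
weak files `Sec3Prop34CnstOfRlfZWeak.lean` (abc-iut-L2-t3), `Sec3Prop34CnstOfRlfQWeak.lean` /
`Sec3Prop34CnstOfRlfRWeak.lean` (abc-iut-L6-t12), the constant line from `Sec3ConstantLineOfRlfWeak.lean`, the
injectivity of `B₀^ℝ → (Φ₀^ℝ)^gp` from `Sec3Thm37UnitsWeak.lean`:

* `thm37_ofRlfZWeak_of_inputs` (`Λ = ℤ`): residual {`hBmon`, `hP34`, `hD`, `hnd`, `hrat`, `hKfix`, `h34`, `h₀`};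
* `thm37_ofRlfQWeak_of_inputs` (`Λ = ℚ`): residual {…, `h34`, `h₀`, `hQ`}; `thm37_iv_ofRlfQWeak_vacuous`;
* `thm37_ofRlfRWeak_of_inputs` (`Λ = ℝ`): residual {…, `h₀`, `hE`} — unit-trivial type outright;
* `thm37_ofRlfZWeak_of_inputs_of_cnst`: `hKfix` replaced by the interface-genre data {`hLine`, `hfin`} (`hInt` is the
  theorem `IsPerfFactorialWeak.Rlf.isCancelMul`);
* `thm37_ofRlfZWeak_of_inputs_of_cosetCnst`: with the PRINTED `D^cnst = 𝓑(G_K)⁰` (`CosetCat` of a compact group):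
  residual {`hBmon`, `hP34`, `hD`, `hnd`, `hrat`, `h34`, `h₀`, `hcyc`} — every item a property of the Def. 3.3 (iii)
  data or a print hypothesis, exactly as in the strong third form.
The strong `thm37_ofRlfR_fin_of_inputs` ("finitely many primes of each `Φ₀(Y)`") is NOT twinned: the weak data exist
precisely for infinitely many primes, where that hypothesis is false.  Seat abc-iut-L6-t12 (gen 4), cell abc-iut,
row «§3 WEAK COLUMN at Λ = ℚ/ℝ» piece (W5).  PROOF-ONLY (0 defs, 0 facts).
HONEST FRAMING: bookkeeping over PROVED rows; refereed pre-IUT material; no statement of [EtTh]/[FrdI] is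
strengthened; every residual is a property of the Def. 3.3 (iii)/3.6 (i) data dischargeable only by the geometric
instantiation (campaign-L side).  Nothing here bears on [IUTchIII] Cor. 3.12.  Typed ≠ proved — here PROVED
modulo the literal binders.
-/

namespace Literature.AnabelianGeometry.EtaleTheta

open CategoryTheory Opposite Literature.AlgebraicGeometry.Frobenioids Literature.AnabelianGeometry.SemiGraphs

namespace TemperedFrobenioid

universe u₀ v₀ u₁ v₁ u v w uK

/-! ### §1 `Λ = ℤ`: the weak constructed data `ofRlfZWeak dm hpf` -/

section OfRlfZWeak

variable {D₀ : Type u₀} [Category.{v₀} D₀] {dm : DivisorMonoids.{u₀, v₀, w} D₀}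
  {hpf : ∀ Y : D₀ᵒᵖ, IsPerfFactorialCof (dm.Φ₀.obj Y)} {V : FrdIMonoidStub.{w}} {V₀ : FrdICatStub.{u₀, v₀, w} D₀}
  {D : Type u} [Category.{v} D] {IsRational IsStrictlyRational : (Dᵒᵖ ⥤ CommMonCat.{w}) → Prop}
  (C₀ : TemperedFrobenioid (RealifiedDivisorMonoids.ofRlfZWeak dm hpf) D
    (treeCatVocab D IsRational IsStrictlyRational))
  {Dcnst : Type u₁} [Category.{v₁} Dcnst] {cnst : D₀ ⥤ Dcnst} (p : ℕ) [Fact p.Prime]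

/-- **[EtTh] Theorem 3.7 (i)–(iv) for a tempered Frobenioid of monoid type `ℤ` over the CONSTRUCTED weak Def. 3.6
(i) data `ofRlfZWeak dm hpf`** (`Φ₀^ℝ = Φ₀^rlf` weak, `B₀^ℤ = B₀`, `F₀^ℤ = F₀`), residual binders literal:
{`hBmon` (R4), `hP34` (R1, Prop. 3.4 (ii) iso 1), `hD`, `hnd`, `hrat`, `hKfix` (G-w5d250-1), `h34 : dm.Prop34`,
`h₀ : dm.Prop34Cnst₀ cnst` (R3′ via abc-iut-L2-t3's `Prop34Cnst.ofRlfZWeak`)}.  Unit-profinite type from `hP34`; the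
`Λ = ℝ` conjunct is vacuous; (iii) both clauses (`Λ = ℤ`). [cite: MochizukiEtTh2009, Thm 3.7 p.79] -/
theorem thm37_ofRlfZWeak_of_inputs (hBmon : IsMonoidOn C₀.ratFnFunctor)
    (hP34 : ∀ A : Dᵒᵖ, ∃ L : PadicFrd.PadicFld.{uK} p, L.IsPadicLocal ∧
      Nonempty ((((RealifiedDivisorMonoids.ofRlfZWeak dm hpf).divΛ (C₀.baseOp A)).comp
        (Units.coeHom ((RealifiedDivisorMonoids.ofRlfZWeak dm hpf).BΛ.obj (C₀.baseOp A)))).ker ≃*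
        PadicFrd.unitSubgroup L.K))
    (hD : IsOfFSMFFType D) (hnd : IsNonDilatingOn C₀.divisorMonoid)
    (hrat : ∀ X : C₀.category,
      PreFrobenioidData.IsRational
        (PreFrobenioid.biratData (C₀.isFrobenioid_treeCatVocab_of_isMonoidOn hBmon)
          (PreFrobenioid.hasBiratSquares_of_isFrobenioid (C₀.isFrobenioid_treeCatVocab_of_isMonoidOn hBmon)))
        (S := PreFrobenioidData.ofFunctor C₀.divisorMonoid C₀.toElem) (fun a 𝔭 => PrimarySupp a 𝔭) X)
    (hKfix : ∀ (A : D) (f : A ≅ A) (b : (RealifiedDivisorMonoids.ofRlfZWeak dm hpf).BΛ.obj (C₀.baseOp (op A)))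
      (ξ : Algebra.GrothendieckGroup (C₀.Φ.carrier (op A))),
      b ∈ (RealifiedDivisorMonoids.ofRlfZWeak dm hpf).FΛ (C₀.baseOp (op A)) → (b, ξ) ∈ C₀.ratFn (op A) →
        pullGp C₀.divisorMonoid f.hom ξ = ξ)
    (h34 : dm.Prop34 V V₀) (h₀ : dm.Prop34Cnst₀ cnst) :
    (PreFrobenioid.IsOfUnitProfiniteType C₀.toElem ∧
      PreFrobenioid.IsOfIsotropicType C₀.toElem ∧
      PreFrobenioid.IsOfModelType C₀.toElem (C₀.isFrobenioid_treeCatVocab_of_isMonoidOn hBmon)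
        (PreFrobenioid.hasBiratSquares_of_isFrobenioid (C₀.isFrobenioid_treeCatVocab_of_isMonoidOn hBmon)) ∧
      PreFrobenioidData.IsOfBiratFrobeniusNormalizedType
        (PreFrobenioid.biratData (C₀.isFrobenioid_treeCatVocab_of_isMonoidOn hBmon)
          (PreFrobenioid.hasBiratSquares_of_isFrobenioid (C₀.isFrobenioid_treeCatVocab_of_isMonoidOn hBmon))) ∧
      PreFrobenioid.IsOfType (PreFrobenioid.IsSubQuasiFrobeniusTrivial C₀.toElem) ∧
      ¬ PreFrobenioid.IsOfType (PreFrobenioid.IsGroupLikeObj C₀.toElem)) ∧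
    ((ModelFrobenioid.data C₀.divisorMonoid C₀.ratFnFunctor C₀.divBNatTrans).IsOfStandardType ∧
      (PreFrobenioidData.ofFunctor C₀.divisorMonoid C₀.toElem).IsOfRationallyStandardType
        (PreFrobenioid.rsParams (C₀.isFrobenioid_treeCatVocab_of_isMonoidOn hBmon) fun a 𝔭 => PrimarySupp a 𝔭)) ∧
    ((∀ A : C₀.category,
        FrobenioidFacade.AutActionFactorsThrough (C₀.base ⋙ cnst) C₀.toElem A) ∧
      (∀ A : C₀.category, FrobenioidFacade.AutActionFaithful (C₀.base ⋙ cnst) C₀.toElem A)) ∧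
    C₀.Thm37_iv := by
  have hZ : C₀.monoidType = MonoidType.Z := rfl
  obtain ⟨⟨hi1, -, hi3, hi4, hi5, hi6, hi7⟩, hii, ⟨hiii1, hiii2⟩, hiv⟩ :=
    C₀.thm37_of_inputs p hBmon (fun _ => hP34) (fun hR => absurd (hZ.symm.trans hR) (by decide)) hD hnd hrat hKfix
      (RealifiedDivisorMonoids.Prop34Cnst.ofRlfZWeak h34 h₀)
  exact ⟨⟨hi1 hZ, hi3, hi4, hi5, hi6, hi7⟩, hii, ⟨hiii1, hiii2 (Or.inl hZ)⟩, hiv⟩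

/-- **`Λ = ℤ` weak constructed data, interface-genre residuals only**: {`hBmon`, `hP34`, `hD`, `hnd`, `hrat`, `h34`,
`h₀`, `hLine`, `hfin`} — `hInt` is the theorem `IsPerfFactorialWeak.Rlf.isCancelMul`, `hKfix` is derived by
abc-iut-w5-d250's `thm37_of_inputs_of_cnst` route, `P` is `Prop34Cnst.ofRlfZWeak h34 h₀`.
[cite: MochizukiEtTh2009, Thm 3.7 p.79] -/
theorem thm37_ofRlfZWeak_of_inputs_of_cnst (hBmon : IsMonoidOn C₀.ratFnFunctor)
    (hP34 : ∀ A : Dᵒᵖ, ∃ L : PadicFrd.PadicFld.{uK} p, L.IsPadicLocal ∧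
      Nonempty ((((RealifiedDivisorMonoids.ofRlfZWeak dm hpf).divΛ (C₀.baseOp A)).comp
        (Units.coeHom ((RealifiedDivisorMonoids.ofRlfZWeak dm hpf).BΛ.obj (C₀.baseOp A)))).ker ≃*
        PadicFrd.unitSubgroup L.K))
    (hD : IsOfFSMFFType D) (hnd : IsNonDilatingOn C₀.divisorMonoid)
    (hrat : ∀ X : C₀.category,
      PreFrobenioidData.IsRational
        (PreFrobenioid.biratData (C₀.isFrobenioid_treeCatVocab_of_isMonoidOn hBmon)
          (PreFrobenioid.hasBiratSquares_of_isFrobenioid (C₀.isFrobenioid_treeCatVocab_of_isMonoidOn hBmon)))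
        (S := PreFrobenioidData.ofFunctor C₀.divisorMonoid C₀.toElem) (fun a 𝔭 => PrimarySupp a 𝔭) X)
    (h34 : dm.Prop34 V V₀) (h₀ : dm.Prop34Cnst₀ cnst)
    (hLine : ∀ (Y : D₀ᵒᵖ) (g : Algebra.GrothendieckGroup ((RealifiedDivisorMonoids.ofRlfZWeak dm hpf).ΦR.obj Y)),
      g ∈ (RealifiedDivisorMonoids.ofRlfZWeak dm hpf).cnstR Y →
        ∃ r : (RealifiedDivisorMonoids.ofRlfZWeak dm hpf).ΦR.obj Y,
          g = Algebra.GrothendieckGroup.of r ∨ g = (Algebra.GrothendieckGroup.of r)⁻¹)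
    (hfin : ∀ (Z : Dcnst) (φ : Aut Z), IsOfFinOrder φ) :
    (PreFrobenioid.IsOfUnitProfiniteType C₀.toElem ∧
      PreFrobenioid.IsOfIsotropicType C₀.toElem ∧
      PreFrobenioid.IsOfModelType C₀.toElem (C₀.isFrobenioid_treeCatVocab_of_isMonoidOn hBmon)
        (PreFrobenioid.hasBiratSquares_of_isFrobenioid (C₀.isFrobenioid_treeCatVocab_of_isMonoidOn hBmon)) ∧
      PreFrobenioidData.IsOfBiratFrobeniusNormalizedType
        (PreFrobenioid.biratData (C₀.isFrobenioid_treeCatVocab_of_isMonoidOn hBmon)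
          (PreFrobenioid.hasBiratSquares_of_isFrobenioid (C₀.isFrobenioid_treeCatVocab_of_isMonoidOn hBmon))) ∧
      PreFrobenioid.IsOfType (PreFrobenioid.IsSubQuasiFrobeniusTrivial C₀.toElem) ∧
      ¬ PreFrobenioid.IsOfType (PreFrobenioid.IsGroupLikeObj C₀.toElem)) ∧
    ((ModelFrobenioid.data C₀.divisorMonoid C₀.ratFnFunctor C₀.divBNatTrans).IsOfStandardType ∧
      (PreFrobenioidData.ofFunctor C₀.divisorMonoid C₀.toElem).IsOfRationallyStandardType
        (PreFrobenioid.rsParams (C₀.isFrobenioid_treeCatVocab_of_isMonoidOn hBmon) fun a 𝔭 => PrimarySupp a 𝔭)) ∧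
    ((∀ A : C₀.category,
        FrobenioidFacade.AutActionFactorsThrough (C₀.base ⋙ cnst) C₀.toElem A) ∧
      (∀ A : C₀.category, FrobenioidFacade.AutActionFaithful (C₀.base ⋙ cnst) C₀.toElem A)) ∧
    C₀.Thm37_iv := by
  have hZ : C₀.monoidType = MonoidType.Z := rfl
  obtain ⟨⟨hi1, -, hi3, hi4, hi5, hi6, hi7⟩, hii, ⟨hiii1, hiii2⟩, hiv⟩ :=
    C₀.thm37_of_inputs_of_cnst p hBmon (fun _ => hP34) (fun hR => absurd (hZ.symm.trans hR) (by decide)) hD hnd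
      hrat (RealifiedDivisorMonoids.Prop34Cnst.ofRlfZWeak h34 h₀) hLine
      (fun Y => IsPerfFactorialWeak.Rlf.isCancelMul (hpf Y).weak) hfin
  exact ⟨⟨hi1 hZ, hi3, hi4, hi5, hi6, hi7⟩, hii, ⟨hiii1, hiii2 (Or.inl hZ)⟩, hiv⟩

end OfRlfZWeak

/-! ### §2 `Λ = ℤ` weak data with the PRINTED constant-field category `D^cnst = 𝓑(G_K)⁰` -/

section OfRlfZWeakCoset

variable {D₀ : Type u₀} [Category.{v₀} D₀] {dm : DivisorMonoids.{u₀, v₀, w} D₀}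
  {hpf : ∀ Y : D₀ᵒᵖ, IsPerfFactorialCof (dm.Φ₀.obj Y)} {V : FrdIMonoidStub.{w}} {V₀ : FrdICatStub.{u₀, v₀, w} D₀}
  {D : Type u} [Category.{v} D] {IsRational IsStrictlyRational : (Dᵒᵖ ⥤ CommMonCat.{w}) → Prop}
  (C₀ : TemperedFrobenioid (RealifiedDivisorMonoids.ofRlfZWeak dm hpf) D
    (treeCatVocab D IsRational IsStrictlyRational))
  {GK : Type u₁} [Group GK] [TopologicalSpace GK] [SeparatelyContinuousMul GK] [CompactSpace GK]
  {cnst : D₀ ⥤ CosetCat GK} (p : ℕ) [Fact p.Prime]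

/-- **[EtTh] Theorem 3.7 (i)–(iv) for the `Λ = ℤ` weak data with `D^cnst = 𝓑(G)⁰` (`G` compact, e.g. `G_K`)** —
residual binders {`hBmon`, `hP34`, `hD`, `hnd`, `hrat`, `h34`, `h₀`, `hcyc`}: `hLine` ⟸ `hcyc`
(`RealifiedDivisorMonoids.ofRlfZWeak_line`), `hfin` ⟸ `CosetCat.isOfFinOrder_aut` (abc-iut-w5-d250).
[cite: MochizukiEtTh2009, Thm 3.7 p.79] -/
theorem thm37_ofRlfZWeak_of_inputs_of_cosetCnst (hBmon : IsMonoidOn C₀.ratFnFunctor)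
    (hP34 : ∀ A : Dᵒᵖ, ∃ L : PadicFrd.PadicFld.{uK} p, L.IsPadicLocal ∧
      Nonempty ((((RealifiedDivisorMonoids.ofRlfZWeak dm hpf).divΛ (C₀.baseOp A)).comp
        (Units.coeHom ((RealifiedDivisorMonoids.ofRlfZWeak dm hpf).BΛ.obj (C₀.baseOp A)))).ker ≃*
        PadicFrd.unitSubgroup L.K))
    (hD : IsOfFSMFFType D) (hnd : IsNonDilatingOn C₀.divisorMonoid)
    (hrat : ∀ X : C₀.category,
      PreFrobenioidData.IsRational
        (PreFrobenioid.biratData (C₀.isFrobenioid_treeCatVocab_of_isMonoidOn hBmon)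
          (PreFrobenioid.hasBiratSquares_of_isFrobenioid (C₀.isFrobenioid_treeCatVocab_of_isMonoidOn hBmon)))
        (S := PreFrobenioidData.ofFunctor C₀.divisorMonoid C₀.toElem) (fun a 𝔭 => PrimarySupp a 𝔭) X)
    (h34 : dm.Prop34 V V₀) (h₀ : dm.Prop34Cnst₀ cnst)
    (hcyc : ∀ Y : D₀ᵒᵖ, ∃ d : dm.Φ₀.obj Y, ∀ b ∈ dm.F₀ Y, ∃ n : ℤ,
      dm.div₀ Y b = Algebra.GrothendieckGroup.of d ^ n)
    :
    (PreFrobenioid.IsOfUnitProfiniteType C₀.toElem ∧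
      PreFrobenioid.IsOfIsotropicType C₀.toElem ∧
      PreFrobenioid.IsOfModelType C₀.toElem (C₀.isFrobenioid_treeCatVocab_of_isMonoidOn hBmon)
        (PreFrobenioid.hasBiratSquares_of_isFrobenioid (C₀.isFrobenioid_treeCatVocab_of_isMonoidOn hBmon)) ∧
      PreFrobenioidData.IsOfBiratFrobeniusNormalizedType
        (PreFrobenioid.biratData (C₀.isFrobenioid_treeCatVocab_of_isMonoidOn hBmon)
          (PreFrobenioid.hasBiratSquares_of_isFrobenioid (C₀.isFrobenioid_treeCatVocab_of_isMonoidOn hBmon))) ∧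
      PreFrobenioid.IsOfType (PreFrobenioid.IsSubQuasiFrobeniusTrivial C₀.toElem) ∧
      ¬ PreFrobenioid.IsOfType (PreFrobenioid.IsGroupLikeObj C₀.toElem)) ∧
    ((ModelFrobenioid.data C₀.divisorMonoid C₀.ratFnFunctor C₀.divBNatTrans).IsOfStandardType ∧
      (PreFrobenioidData.ofFunctor C₀.divisorMonoid C₀.toElem).IsOfRationallyStandardType
        (PreFrobenioid.rsParams (C₀.isFrobenioid_treeCatVocab_of_isMonoidOn hBmon) fun a 𝔭 => PrimarySupp a 𝔭)) ∧
    ((∀ A : C₀.category,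
        FrobenioidFacade.AutActionFactorsThrough (C₀.base ⋙ cnst) C₀.toElem A) ∧
      (∀ A : C₀.category, FrobenioidFacade.AutActionFaithful (C₀.base ⋙ cnst) C₀.toElem A)) ∧
    C₀.Thm37_iv :=
  C₀.thm37_ofRlfZWeak_of_inputs_of_cnst p hBmon hP34 hD hnd hrat h34 h₀
    (RealifiedDivisorMonoids.ofRlfZWeak_line dm hpf hcyc) fun Z φ => CosetCat.isOfFinOrder_aut Z φ

end OfRlfZWeakCoset

/-! ### §3 `Λ = ℚ`: the weak constructed data `ofRlfQWeak dm hpf` -/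

section OfRlfQWeak

variable {D₀ : Type u₀} [Category.{v₀} D₀] {dm : DivisorMonoids.{u₀, v₀, w} D₀}
  {hpf : ∀ Y : D₀ᵒᵖ, IsPerfFactorialCof (dm.Φ₀.obj Y)} {V : FrdIMonoidStub.{w}} {V₀ : FrdICatStub.{u₀, v₀, w} D₀}
  {D : Type u} [Category.{v} D] {IsRational IsStrictlyRational : (Dᵒᵖ ⥤ CommMonCat.{w}) → Prop}
  (C₀ : TemperedFrobenioid (RealifiedDivisorMonoids.ofRlfQWeak dm hpf) D
    (treeCatVocab D IsRational IsStrictlyRational))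
  {Dcnst : Type u₁} [Category.{v₁} Dcnst] {cnst : D₀ ⥤ Dcnst}

/-- **[EtTh] Theorem 3.7 (i)–(iii) for a tempered Frobenioid of monoid type `ℚ` over the CONSTRUCTED weak data
`ofRlfQWeak dm hpf`** (`B₀^ℚ = B₀^pf`, `F₀^ℚ = F₀^pf`), residual binders literal: {`hBmon`, `hD`, `hnd`, `hrat`,
`hKfix`, `h34 : dm.Prop34`, `h₀ : dm.Prop34Cnst₀ cnst`, **`hQ`** (automorphisms agreeing on `Ker(div₀)` up to torsion
have the same image under `cnst` — the kernel-exact residual of clause 4, `Sec3Prop34CnstOfRlfQWeak`)}.  Both unit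
conjuncts of (i) and clause (iv) are VACUOUS at `Λ = ℚ`; (iii) second clause applies (`Λ ∈ {ℤ, ℚ}`).
[cite: MochizukiEtTh2009, Thm 3.7 p.79] -/
theorem thm37_ofRlfQWeak_of_inputs (hBmon : IsMonoidOn C₀.ratFnFunctor)
    (hD : IsOfFSMFFType D) (hnd : IsNonDilatingOn C₀.divisorMonoid)
    (hrat : ∀ X : C₀.category,
      PreFrobenioidData.IsRational
        (PreFrobenioid.biratData (C₀.isFrobenioid_treeCatVocab_of_isMonoidOn hBmon)
          (PreFrobenioid.hasBiratSquares_of_isFrobenioid (C₀.isFrobenioid_treeCatVocab_of_isMonoidOn hBmon)))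
        (S := PreFrobenioidData.ofFunctor C₀.divisorMonoid C₀.toElem) (fun a 𝔭 => PrimarySupp a 𝔭) X)
    (hKfix : ∀ (A : D) (f : A ≅ A) (b : (RealifiedDivisorMonoids.ofRlfQWeak dm hpf).BΛ.obj (C₀.baseOp (op A)))
      (ξ : Algebra.GrothendieckGroup (C₀.Φ.carrier (op A))),
      b ∈ (RealifiedDivisorMonoids.ofRlfQWeak dm hpf).FΛ (C₀.baseOp (op A)) → (b, ξ) ∈ C₀.ratFn (op A) →
        pullGp C₀.divisorMonoid f.hom ξ = ξ)
    (h34 : dm.Prop34 V V₀) (h₀ : dm.Prop34Cnst₀ cnst)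
    (hQ : ∀ {Y : D₀} (g g' : Y ≅ Y),
      (∀ b : dm.B₀.obj (op Y), dm.div₀ (op Y) b = 1 →
        ∃ N : ℕ+, ((dm.B₀.map g.hom.op).hom b) ^ (N : ℕ) = ((dm.B₀.map g'.hom.op).hom b) ^ (N : ℕ)) →
      cnst.map g.hom = cnst.map g'.hom)
    :
    (PreFrobenioid.IsOfIsotropicType C₀.toElem ∧
      PreFrobenioid.IsOfModelType C₀.toElem (C₀.isFrobenioid_treeCatVocab_of_isMonoidOn hBmon)
        (PreFrobenioid.hasBiratSquares_of_isFrobenioid (C₀.isFrobenioid_treeCatVocab_of_isMonoidOn hBmon)) ∧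
      PreFrobenioidData.IsOfBiratFrobeniusNormalizedType
        (PreFrobenioid.biratData (C₀.isFrobenioid_treeCatVocab_of_isMonoidOn hBmon)
          (PreFrobenioid.hasBiratSquares_of_isFrobenioid (C₀.isFrobenioid_treeCatVocab_of_isMonoidOn hBmon))) ∧
      PreFrobenioid.IsOfType (PreFrobenioid.IsSubQuasiFrobeniusTrivial C₀.toElem) ∧
      ¬ PreFrobenioid.IsOfType (PreFrobenioid.IsGroupLikeObj C₀.toElem)) ∧
    ((ModelFrobenioid.data C₀.divisorMonoid C₀.ratFnFunctor C₀.divBNatTrans).IsOfStandardType ∧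
      (PreFrobenioidData.ofFunctor C₀.divisorMonoid C₀.toElem).IsOfRationallyStandardType
        (PreFrobenioid.rsParams (C₀.isFrobenioid_treeCatVocab_of_isMonoidOn hBmon) fun a 𝔭 => PrimarySupp a 𝔭)) ∧
    ((∀ A : C₀.category,
        FrobenioidFacade.AutActionFactorsThrough (C₀.base ⋙ cnst) C₀.toElem A) ∧
      (∀ A : C₀.category, FrobenioidFacade.AutActionFaithful (C₀.base ⋙ cnst) C₀.toElem A)) := by
  have hQΛ : C₀.monoidType = MonoidType.Q := rfl
  obtain ⟨⟨-, -, hi3, hi4, hi5, hi6, hi7⟩, hii, ⟨hiii1, hiii2⟩, -⟩ :=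
    thm37_of_inputs.{u₀, v₀, u₁, v₁, u, v, w, 0} C₀ 2 hBmon (fun hZ => absurd (hQΛ.symm.trans hZ) (by decide))
      (fun hR => absurd (hQΛ.symm.trans hR) (by decide)) hD hnd hrat hKfix
      (RealifiedDivisorMonoids.Prop34Cnst.ofRlfQWeak h34 h₀ hQ)
  exact ⟨⟨hi3, hi4, hi5, hi6, hi7⟩, hii, ⟨hiii1, hiii2 (Or.inr hQΛ)⟩⟩

/-- At `Λ = ℚ` (weak data) the typed clause (iv) holds VACUOUSLY (its hypothesis `Λ ∈ {ℤ, ℝ}` fails), for the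
record. [cite: MochizukiEtTh2009, Thm 3.7 p.80] -/
theorem thm37_iv_ofRlfQWeak_vacuous :
    TemperedFrobenioid.Thm37_iv (T := RealifiedDivisorMonoids.ofRlfQWeak dm hpf) C₀ := by
  have hQΛ : C₀.monoidType = MonoidType.Q := rfl
  intro _ hΛ
  rcases hΛ with h | h
  · exact absurd (hQΛ.symm.trans h) (by decide)
  · exact absurd (hQΛ.symm.trans h) (by decide)

end OfRlfQWeak

/-! ### §4 `Λ = ℝ`: the weak constructed data `ofRlfRWeak dm hpf` -/

section OfRlfRWeak

variable {D₀ : Type u₀} [Category.{v₀} D₀] {dm : DivisorMonoids.{u₀, v₀, w} D₀}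
  {hpf : ∀ Y : D₀ᵒᵖ, IsPerfFactorialCof (dm.Φ₀.obj Y)} {V : FrdIMonoidStub.{w}} {V₀ : FrdICatStub.{u₀, v₀, w} D₀}
  {D : Type u} [Category.{v} D] {IsRational IsStrictlyRational : (Dᵒᵖ ⥤ CommMonCat.{w}) → Prop}
  (C₀ : TemperedFrobenioid (RealifiedDivisorMonoids.ofRlfRWeak dm hpf) D
    (treeCatVocab D IsRational IsStrictlyRational))
  {Dcnst : Type u₁} [Category.{v₁} Dcnst] {cnst : D₀ ⥤ Dcnst}

/-- **[EtTh] Theorem 3.7 (i)–(iv) for a tempered Frobenioid of monoid type `ℝ` over the CONSTRUCTED weak data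
`ofRlfRWeak dm hpf`** (`B₀^ℝ = ℝ·Φ₀^birat`, `F₀^ℝ = ℝ·Φ₀^cnst`), residual binders literal:
{`hBmon`, `hD`, `hnd`, `hrat`, `hKfix`, `h₀ : dm.Prop34Cnst₀ cnst`, **`hE`** (clause 1 of Prop. 3.4 (ii) at `Λ = ℝ` for
THE weak realification data — the exact residual, `Sec3Prop34CnstOfRlfRWeak`)}.  Unit-TRIVIAL type outright
(`ofRlfRWeak_divΛ_injective`, abc-iut-L6-t12 gen 3); unit-profinite conjunct and (iii) second clause vacuous
(`Λ = ℝ`); (iv) outright modulo `hBmon`. [cite: MochizukiEtTh2009, Thm 3.7 p.79] -/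
theorem thm37_ofRlfRWeak_of_inputs (hBmon : IsMonoidOn C₀.ratFnFunctor)
    (hD : IsOfFSMFFType D) (hnd : IsNonDilatingOn C₀.divisorMonoid)
    (hrat : ∀ X : C₀.category,
      PreFrobenioidData.IsRational
        (PreFrobenioid.biratData (C₀.isFrobenioid_treeCatVocab_of_isMonoidOn hBmon)
          (PreFrobenioid.hasBiratSquares_of_isFrobenioid (C₀.isFrobenioid_treeCatVocab_of_isMonoidOn hBmon)))
        (S := PreFrobenioidData.ofFunctor C₀.divisorMonoid C₀.toElem) (fun a 𝔭 => PrimarySupp a 𝔭) X)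
    (hKfix : ∀ (A : D) (f : A ≅ A) (b : (RealifiedDivisorMonoids.ofRlfRWeak dm hpf).BΛ.obj (C₀.baseOp (op A)))
      (ξ : Algebra.GrothendieckGroup (C₀.Φ.carrier (op A))),
      b ∈ (RealifiedDivisorMonoids.ofRlfRWeak dm hpf).FΛ (C₀.baseOp (op A)) → (b, ξ) ∈ C₀.ratFn (op A) →
        pullGp C₀.divisorMonoid f.hom ξ = ξ)
    (h₀ : dm.Prop34Cnst₀ cnst)
    (hE : ∀ (Y : D₀)
      (b : Algebra.GrothendieckGroup ((RealifiedDivisorMonoids.realDataWeak dm hpf).rlf.obj (op Y)))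
      (x : (hpf (op Y)).weak.Rlf),
      b ∈ ((RealifiedDivisorMonoids.realDataWeak dm hpf).realSpan dm.biratGp).carrier Y →
        b = Algebra.GrothendieckGroup.of x →
        b ∈ ((RealifiedDivisorMonoids.realDataWeak dm hpf).realSpan dm.cnstGp).carrier Y) :
    (PreFrobenioid.IsOfType (PreFrobenioid.IsUnitTrivial C₀.toElem) ∧
      PreFrobenioid.IsOfIsotropicType C₀.toElem ∧
      PreFrobenioid.IsOfModelType C₀.toElem (C₀.isFrobenioid_treeCatVocab_of_isMonoidOn hBmon)
        (PreFrobenioid.hasBiratSquares_of_isFrobenioid (C₀.isFrobenioid_treeCatVocab_of_isMonoidOn hBmon)) ∧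
      PreFrobenioidData.IsOfBiratFrobeniusNormalizedType
        (PreFrobenioid.biratData (C₀.isFrobenioid_treeCatVocab_of_isMonoidOn hBmon)
          (PreFrobenioid.hasBiratSquares_of_isFrobenioid (C₀.isFrobenioid_treeCatVocab_of_isMonoidOn hBmon))) ∧
      PreFrobenioid.IsOfType (PreFrobenioid.IsSubQuasiFrobeniusTrivial C₀.toElem) ∧
      ¬ PreFrobenioid.IsOfType (PreFrobenioid.IsGroupLikeObj C₀.toElem)) ∧
    ((ModelFrobenioid.data C₀.divisorMonoid C₀.ratFnFunctor C₀.divBNatTrans).IsOfStandardType ∧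
      (PreFrobenioidData.ofFunctor C₀.divisorMonoid C₀.toElem).IsOfRationallyStandardType
        (PreFrobenioid.rsParams (C₀.isFrobenioid_treeCatVocab_of_isMonoidOn hBmon) fun a 𝔭 => PrimarySupp a 𝔭)) ∧
    (∀ A : C₀.category, FrobenioidFacade.AutActionFactorsThrough (C₀.base ⋙ cnst) C₀.toElem A) ∧
    C₀.Thm37_iv := by
  have hR : C₀.monoidType = MonoidType.R := rfl
  obtain ⟨⟨-, hi2, hi3, hi4, hi5, hi6, hi7⟩, hii, ⟨hiii1, -⟩, hiv⟩ :=
    thm37_of_inputs.{u₀, v₀, u₁, v₁, u, v, w, 0} C₀ 2 hBmon (fun hZ => absurd (hR.symm.trans hZ) (by decide))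
      (fun _ A => RealifiedDivisorMonoids.ofRlfRWeak_divΛ_injective dm hpf (C₀.baseOp A)) hD hnd hrat hKfix
      (RealifiedDivisorMonoids.Prop34Cnst.ofRlfRWeak_of_eff h₀ hE)
  exact ⟨⟨hi2 hR, hi3, hi4, hi5, hi6, hi7⟩, hii, hiii1, hiv⟩

end OfRlfRWeak

end TemperedFrobenioid

end Literature.AnabelianGeometry.EtaleTheta
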